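/-
Copyright (c) 2026 the pub-hodgecm-mathlib formalisation cell (harness21).  Prover seat hodgecm-mathlib-K2E3-p23 (g5), HCML Track B «K2-LIT» ∕ h413
(`stmt-HodgeConjecture-24833`), line `K2_E3_EllipticInputs`, unit U12 «Characters», road «GL-[M6]-sc» (line lead K2E3-p23 (g5), dealer K2E3-plan (g3)),
MEMO «M6sc-BLUEPRINT v4» §2 brick VOL-mixed, CORE COUNT: the shell count behind Harish-Chandra's Theorem 14 for the ELLIPTIC torus of `GL₂(F)`.  2026-09-04.
-/
import Literature.NumberTheory.Automorphic.LocalFieldHaarBalls   -- ★ `measurable_normAbs`; brings `TateLocalZetaShells` (shells, `measure_shell`, `addHaar_smul_set`)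
import Summits.HodgeConjecture.HodgeConjecture.Theorems.K2E3LocalFieldSquaresHensel   -- ★ (ED. 3) `exists_sq_add_mul_eq` (Hensel for `h² + a h = y`)
import HarnessLib

/-!
# Road «GL-[M6]-sc», brick VOL-mixed, CORE COUNT: `∫_F μ'{a ∈ Fˣ : q^{-A} ≤ |a|, |a|·Φ(b) ≤ q^{-B}} db ≤ n · μ'(𝒪ˣ) · μ(𝔭^{-K})`, `K = ⌊(n−1)/2⌋`
# — the `|D|^{-1/2}` count of conjugates of an elliptic element of `GL₂(F)` in a height ball (Harish-Chandra 1970, Part VII §3, Theorem 14 for `T_E ⊂ GL₂`)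

Cell `pub/hodgecm-mathlib` (D-0151), Track B «K2-LIT», crux H413 = `stmt-HodgeConjecture-24833`, route of record `HCCMUnconditional`.  Lane
`--supports stmt-HodgeConjecture-24833 --as helper`; THEOREMS ONLY (no `def`, no `instance`, no `notation`, no named-fact hypothesis, no `sorry`); count-neutral.

WHAT.  `F` a non-archimedean local field, `|·| = normAbs F`, `q = residueFieldCard F`, `μ` an additive Haar measure of `F`, `μ'` a left-invariant measure of `Fˣ`
(all shells `{|a| = q^{-j}}` have the same mass `μ'(𝒪ˣ)`, ★ `measure_shell`).  For integers `A B : ℤ`, `l : ℕ` and ANY `Φ : F → ℝ≥0` with the anisotropy bound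
`q^{-l} · max(1, |b|²) ≤ Φ(b)`:
* `measure_shellRange_le_card_mul` — for each `b`, `μ'{a : q^{-A} ≤ |a| ∧ |a|·Φ(b) ≤ q^{-B}} ≤ (n − 2k)₊ · μ'(𝒪ˣ)` where `n = A − B + l + 1` and `|b| = q^{k}` (`k ≥ 0`; `k = 0` when
  `|b| ≤ 1`): the admissible shells are `j ∈ [B − l + 2k, A]`;
* `measure_shellRange_eq_zero_of_lt` — the set is EMPTY-in-measure once `|b| > q^{K}`, `K = ⌊(n−1)/2⌋`;
* **`lintegral_measure_shellRange_le`** — `∫⁻ b, μ'{…} dμ ≤ n₊ · μ'(𝒪ˣ) · μ{b : |b| ≤ q^{K}}`;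
* `measure_normAbs_le_zpow` — `μ{|b| ≤ q^{K}} = q^{K} · μ(𝒪)`, so the bound is `n₊ · q^{⌊(n−1)/2⌋} · μ'(𝒪ˣ) · μ(𝒪)`.
WHY (consumer = VOL-mixed assembly `K2E3GL3MixedConjugacyVolume`).  For `γ₁ = [[u + wT, w], [−wN, u]]` (multiplication by `e = u + wτ ∈ E = F(τ)`, `τ² = Tτ − N`, `w ≠ 0`) and
`β = diag(a,1)·[[1,b],[0,1]]` running over the group `B₁ ≅ Fˣ ⋉ F`, which acts simply transitively on `E ∖ F = GL₂(F)/Eˣ` and carries the left Haar measure `dμ'(a) dμ(b)`,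
`β γ₁ β⁻¹ = [[u + wT − b w N, a · w · Nm_{E/F}(1 − bτ)], [−wN/a, u + b w N]]`; so «`β γ₁ β⁻¹` lies in the height ball of radius `m`» forces `|wN| q^{-m} ≤ |a|` and
`|a| · |w| · |Nm(1 − bτ)| ≤ q^{m}`, i.e. the shell range above with `Φ(b) = |w|·|Nm(1 − bτ)|`, `q^{-A} = |wN| q^{-m}`, `q^{-B} = q^{m}`, `q^{-l} = |w| · κ_E`
(anisotropy of the norm form: `κ_E max(1,|b|)² ≤ |Nm(1 − bτ)|`).  Then `n = 2m + 1 + l_E + v(N) + 2 v(w)` and `q^{⌊(n−1)/2⌋} ≍_E q^{m} |w|⁻¹ = q^m |D(γ₁)|^{-1/2} |τ − τ̄|`: the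
conjugates of `γ₁` of height `≤ m` have `B₁`-volume `O_{E,m}(|D(γ₁)|^{-1/2} · log)`, which is Theorem 14 for the elliptic torus `Eˣ ⊂ GL₂(F)` with a logarithmic loss — enough for the
road, whose weight is `|D♮|^{-1/2} · polylog` against T15-log (BLUEPRINT v4 §0.2).
HONEST LABEL: HC_CM is proved only modulo the 7 printed citations (2 remaining named inputs: hLiu418 = stmt-HodgeConjecture-24832, h413 = stmt-HodgeConjecture-24833) until
rung 0 closes; count-neutral helper, closes no socket.

## References
* [HarishChandra1970] Harish-Chandra (notes by G. van Dijk), *Harmonic Analysis on Reductive p-adic Groups*, LNM 162 (1970), Part VII §1 Theorem 14 p. 60, §3 p. 72.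
* [Tate1950] J. Tate, *Fourier analysis in number fields and Hecke's zeta-functions* (1950), §2.2 Lemma 2.2.5, §2.5 (shells `A_ν = π^ν u`).
* [BushnellHenniart2006] C. J. Bushnell, G. Henniart, *The local Langlands conjecture for GL(2)* (2006), §1.1.
-/

set_option autoImplicit false
-- the mandated namespace repeats the single-problem summit's segment (`HodgeConjecture.HodgeConjecture`)
set_option linter.dupNamespace false

noncomputable section

open scoped NNReal ENNReal Pointwise
open MeasureTheory Set ValuativeRel Literature.NumberTheory.Automorphic Literature.NumberTheory.GaloisRepresentations.IsNonarchimedeanLocalField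

namespace Summit.HodgeConjecture.HodgeConjecture.Cruxes.H413.K2E3GL2EllipticConjugacyCount

variable {F : Type*} [Field F] [ValuativeRel F] [TopologicalSpace F] [IsNonarchimedeanLocalField F]

/-! ## §1 Exponents: `max(1, |b|²) = q^{2k}` with `k : ℕ`, and the admissible shells -/

/-- Every `b : F` has a «positive height» `k : ℕ` with `max(1, |b|²) = (q⁻¹)^{-2k}` and (`b ≠ 0 ⇒`) `|b| ≤ (q⁻¹)^{-k}`; `k = 0` when `|b| ≤ 1`. [folklore] -/
theorem exists_max_one_sq_eq_zpow (b : F) :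
    ∃ k : ℕ, max 1 (normAbs F b ^ 2) = ((residueFieldCard F : ℝ≥0)⁻¹) ^ (-(2 * (k : ℤ))) ∧
      normAbs F b ≤ ((residueFieldCard F : ℝ≥0)⁻¹) ^ (-(k : ℤ)) := by
  by_cases hb : b = 0
  · refine ⟨0, ?_, ?_⟩
    · simp [hb]
    · simp [hb]
  obtain ⟨j, hj⟩ := exists_normAbs_eq_inv_zpow hb
  by_cases hj0 : 0 ≤ j
  · -- `|b| ≤ 1`
    have hle : normAbs F b ≤ 1 := by
      rw [hj, ← zpow_zero ((residueFieldCard F : ℝ≥0)⁻¹)]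
      exact inv_residueFieldCard_zpow_le_iff.2 hj0
    refine ⟨0, ?_, ?_⟩
    · rw [Nat.cast_zero, mul_zero, neg_zero, zpow_zero, max_eq_left]
      exact pow_le_one₀ bot_le hle
    · rwa [Nat.cast_zero, neg_zero, zpow_zero]
  · push Not at hj0
    refine ⟨(-j).toNat, ?_, ?_⟩
    · have hk : ((-j).toNat : ℤ) = -j := Int.toNat_of_nonneg (by omega)
      rw [hk, neg_mul_eq_mul_neg, neg_neg, max_eq_right, hj, ← zpow_natCast, ← zpow_mul]
      · congr 1
        push_cast
        ring
      · rw [hj, ← zpow_natCast, ← zpow_mul, ← zpow_zero ((residueFieldCard F : ℝ≥0)⁻¹)]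
        refine inv_residueFieldCard_zpow_le_iff.2 ?_
        push_cast
        omega
    · have hk : ((-j).toNat : ℤ) = -j := Int.toNat_of_nonneg (by omega)
      rw [hk, neg_neg, hj]

/-- **The admissible shells.**  If `q^{-l} max(1,|b|²) ≤ Φ(b)`, `max(1,|b|²) = q^{2k}`, and `a ∈ Fˣ` satisfies `(q⁻¹)^A ≤ |a|` and `|a| Φ(b) ≤ (q⁻¹)^B`, then `|a| = (q⁻¹)^j` with
`B − l + 2k ≤ j ≤ A`. [cite: HarishChandra1970, Part VII §3 p. 72] -/
theorem exists_normAbs_eq_zpow_mem_Icc {Φ : F → ℝ≥0} {l : ℕ} {A B : ℤ} {b : F} {k : ℕ}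
    (hΦ : ((residueFieldCard F : ℝ≥0)⁻¹) ^ (l : ℤ) * max 1 (normAbs F b ^ 2) ≤ Φ b)
    (hk : max 1 (normAbs F b ^ 2) = ((residueFieldCard F : ℝ≥0)⁻¹) ^ (-(2 * (k : ℤ))))
    {a : Fˣ} (hA : ((residueFieldCard F : ℝ≥0)⁻¹) ^ A ≤ normAbs F (a : F))
    (hB : normAbs F (a : F) * Φ b ≤ ((residueFieldCard F : ℝ≥0)⁻¹) ^ B) :
    ∃ j ∈ Finset.Icc (B - l + 2 * k) A, normAbs F (a : F) = ((residueFieldCard F : ℝ≥0)⁻¹) ^ j := by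
  obtain ⟨j, hj⟩ := exists_normAbs_eq_inv_zpow a.ne_zero
  refine ⟨j, Finset.mem_Icc.2 ⟨?_, ?_⟩, hj⟩
  · -- lower bound from `hΦ`, `hk`, `hB`
    have h1 : ((residueFieldCard F : ℝ≥0)⁻¹) ^ j * (((residueFieldCard F : ℝ≥0)⁻¹) ^ (l : ℤ) *
        ((residueFieldCard F : ℝ≥0)⁻¹) ^ (-(2 * (k : ℤ)))) ≤ ((residueFieldCard F : ℝ≥0)⁻¹) ^ B := by
      rw [← hk, ← hj]
      exact (mul_le_mul_of_nonneg_left hΦ bot_le).trans hB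
    rw [← zpow_add₀ inv_residueFieldCard_pos.ne', ← zpow_add₀ inv_residueFieldCard_pos.ne',
      inv_residueFieldCard_zpow_le_iff] at h1
    omega
  · exact inv_residueFieldCard_zpow_le_iff.1 (hj ▸ hA)

variable [MeasurableSpace F] [BorelSpace F]

/-! ## §2 The count for one `b` -/

omit [BorelSpace F] in
/-- **`μ'{a : (q⁻¹)^A ≤ |a| ∧ |a| Φ(b) ≤ (q⁻¹)^B} ≤ (A − B + l − 2k + 1)₊ · μ'(𝒪ˣ)`** (`max(1,|b|²) = q^{2k}`): the set lies in the union of the shells `j ∈ [B − l + 2k, A]`,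
each of mass `μ'(𝒪ˣ)` (★ `measure_shell`). [cite: HarishChandra1970, Part VII §3 p. 72] [cite: Tate1950, §2.5] -/
theorem measure_shellRange_le_card_mul (μ' : Measure Fˣ) [μ'.IsMulLeftInvariant] {Φ : F → ℝ≥0} {l : ℕ} {A B : ℤ} {b : F} {k : ℕ}
    (hΦ : ((residueFieldCard F : ℝ≥0)⁻¹) ^ (l : ℤ) * max 1 (normAbs F b ^ 2) ≤ Φ b)
    (hk : max 1 (normAbs F b ^ 2) = ((residueFieldCard F : ℝ≥0)⁻¹) ^ (-(2 * (k : ℤ)))) :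
    μ' {a : Fˣ | ((residueFieldCard F : ℝ≥0)⁻¹) ^ A ≤ normAbs F (a : F) ∧ normAbs F (a : F) * Φ b ≤ ((residueFieldCard F : ℝ≥0)⁻¹) ^ B} ≤
      ((A - B + l - 2 * k + 1).toNat : ℝ≥0∞) * μ' {x : Fˣ | valuation F (x : F) = 1} := by
  have hsub : {a : Fˣ | ((residueFieldCard F : ℝ≥0)⁻¹) ^ A ≤ normAbs F (a : F) ∧
        normAbs F (a : F) * Φ b ≤ ((residueFieldCard F : ℝ≥0)⁻¹) ^ B} ⊆
      ⋃ j ∈ Finset.Icc (B - l + 2 * k) A, {x : Fˣ | normAbs F (x : F) = ((residueFieldCard F : ℝ≥0)⁻¹) ^ j} := by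
    intro a ha
    obtain ⟨j, hj, hja⟩ := exists_normAbs_eq_zpow_mem_Icc hΦ hk ha.1 ha.2
    exact Set.mem_biUnion hj hja
  refine (measure_mono hsub).trans ((measure_biUnion_finset_le _ _).trans ?_)
  simp only [measure_shell μ']
  rw [Finset.sum_const, nsmul_eq_mul, Int.card_Icc]
  gcongr
  norm_cast
  omega

omit [BorelSpace F] in
/-- **Beyond `|b| = q^{⌊(n−1)/2⌋}` the set is null**: if `max(1,|b|²) = q^{2k}` with `n − 2k ≤ 0` (`n = A − B + l + 1`) the count is `0`.
[cite: HarishChandra1970, Part VII §3 p. 72] -/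
theorem measure_shellRange_eq_zero_of_le (μ' : Measure Fˣ) [μ'.IsMulLeftInvariant] {Φ : F → ℝ≥0} {l : ℕ} {A B : ℤ} {b : F} {k : ℕ}
    (hΦ : ((residueFieldCard F : ℝ≥0)⁻¹) ^ (l : ℤ) * max 1 (normAbs F b ^ 2) ≤ Φ b)
    (hk : max 1 (normAbs F b ^ 2) = ((residueFieldCard F : ℝ≥0)⁻¹) ^ (-(2 * (k : ℤ))))
    (hn : A - B + l + 1 ≤ 2 * k) :
    μ' {a : Fˣ | ((residueFieldCard F : ℝ≥0)⁻¹) ^ A ≤ normAbs F (a : F) ∧ normAbs F (a : F) * Φ b ≤ ((residueFieldCard F : ℝ≥0)⁻¹) ^ B} = 0 := by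
  refine le_antisymm ((measure_shellRange_le_card_mul μ' hΦ hk).trans ?_) bot_le
  rw [Int.toNat_of_nonpos (by omega), Nat.cast_zero, zero_mul]

/-! ## §3 The count integrated over `b` -/

/-- **THE CORE COUNT.**  `∫⁻ b, μ'{a : (q⁻¹)^A ≤ |a| ∧ |a| Φ(b) ≤ (q⁻¹)^B} dμ ≤ n₊ · μ'(𝒪ˣ) · μ{b : |b| ≤ q^{⌊(n−1)/2⌋}}`, `n = A − B + l + 1`, for ANY `Φ` with
`q^{-l} max(1,|b|²) ≤ Φ(b)`: pointwise the integrand is `≤ n₊ μ'(𝒪ˣ)` (§2) and vanishes unless `|b| ≤ q^{⌊(n−1)/2⌋}`.  This is Harish-Chandra's Theorem 14 for the elliptic torus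
`Eˣ ⊂ GL₂(F)` in the form the road uses (`B₁ ≅ Fˣ ⋉ F` coordinates, logarithmic loss `n₊`). [cite: HarishChandra1970, Part VII §1 Theorem 14 p. 60; §3 p. 72] -/
theorem lintegral_measure_shellRange_le (μ' : Measure Fˣ) [μ'.IsMulLeftInvariant] (μ : Measure F) {Φ : F → ℝ≥0} {l : ℕ} {A B : ℤ}
    (hΦ : ∀ b, ((residueFieldCard F : ℝ≥0)⁻¹) ^ (l : ℤ) * max 1 (normAbs F b ^ 2) ≤ Φ b) :
    ∫⁻ b, μ' {a : Fˣ | ((residueFieldCard F : ℝ≥0)⁻¹) ^ A ≤ normAbs F (a : F) ∧ normAbs F (a : F) * Φ b ≤ ((residueFieldCard F : ℝ≥0)⁻¹) ^ B} ∂μ ≤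
      ((A - B + l + 1).toNat : ℝ≥0∞) * μ' {x : Fˣ | valuation F (x : F) = 1} *
        μ {b : F | normAbs F b ≤ ((residueFieldCard F : ℝ≥0)⁻¹) ^ (-(((A - B + l + 1 - 1) / 2).toNat : ℤ))} := by
  set n : ℤ := A - B + l + 1 with hn
  set T : Set F := {b : F | normAbs F b ≤ ((residueFieldCard F : ℝ≥0)⁻¹) ^ (-(((n - 1) / 2).toNat : ℤ))} with hT
  have hTm : MeasurableSet T := measurableSet_le LocalFieldHaar.measurable_normAbs measurable_const
  -- pointwise bound by `n₊ μ'(𝒪ˣ) · 1_T`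
  have hpt : ∀ b, μ' {a : Fˣ | ((residueFieldCard F : ℝ≥0)⁻¹) ^ A ≤ normAbs F (a : F) ∧
      normAbs F (a : F) * Φ b ≤ ((residueFieldCard F : ℝ≥0)⁻¹) ^ B} ≤
      T.indicator (fun _ => (n.toNat : ℝ≥0∞) * μ' {x : Fˣ | valuation F (x : F) = 1}) b := by
    intro b
    obtain ⟨k, hk, hbk⟩ := exists_max_one_sq_eq_zpow b
    by_cases hnk : n ≤ 2 * k
    · rw [measure_shellRange_eq_zero_of_le μ' (hΦ b) hk (by omega)]
      exact bot_le
    · push Not at hnk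
      have hbT : b ∈ T := by
        refine hbk.trans (inv_residueFieldCard_zpow_le_iff.2 ?_)
        have : (k : ℤ) ≤ (n - 1) / 2 := by omega
        have h2 : (((n - 1) / 2).toNat : ℤ) = (n - 1) / 2 := Int.toNat_of_nonneg (by omega)
        omega
      rw [Set.indicator_of_mem hbT]
      refine (measure_shellRange_le_card_mul μ' (hΦ b) hk).trans ?_
      gcongr
      omega
  calc ∫⁻ b, μ' {a : Fˣ | ((residueFieldCard F : ℝ≥0)⁻¹) ^ A ≤ normAbs F (a : F) ∧
          normAbs F (a : F) * Φ b ≤ ((residueFieldCard F : ℝ≥0)⁻¹) ^ B} ∂μ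
      ≤ ∫⁻ b, T.indicator (fun _ => (n.toNat : ℝ≥0∞) * μ' {x : Fˣ | valuation F (x : F) = 1}) b ∂μ := lintegral_mono hpt
    _ = (n.toNat : ℝ≥0∞) * μ' {x : Fˣ | valuation F (x : F) = 1} * μ T := by
        rw [lintegral_indicator_const hTm]

/-! ## §4 The mass of the `b`-ball -/

omit [MeasurableSpace F] [BorelSpace F] in
/-- `{b : |b| ≤ (q⁻¹)^{K}} = ϖ^{K} • 𝒪` for a uniformiser `ϖ` (`|ϖ| = q⁻¹`). [cite: Tate1950, §2.5] -/
theorem setOf_normAbs_le_zpow_eq_smul {ϖ : F} (hϖ : normAbs F ϖ = (residueFieldCard F : ℝ≥0)⁻¹) (hϖ0 : ϖ ≠ 0) (K : ℤ) :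
    {b : F | normAbs F b ≤ ((residueFieldCard F : ℝ≥0)⁻¹) ^ K} = (ϖ ^ K) • {b : F | normAbs F b ≤ 1} := by
  ext b
  rw [Set.mem_smul_set_iff_inv_smul_mem₀ (zpow_ne_zero K hϖ0), Set.mem_setOf_eq, Set.mem_setOf_eq, smul_eq_mul, map_mul, map_inv₀,
    normAbs_zpow_of_normAbs_eq hϖ, inv_mul_le_iff₀ (zpow_pos inv_residueFieldCard_pos K), mul_one]

/-- **`μ{b : |b| ≤ q^{K}} = q^{K} · μ(𝒪)`** (Tate's Lemma 2.2.5 `μ(aM) = |a| μ(M)`). [cite: Tate1950, §2.2 Lemma 2.2.5] -/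
theorem measure_normAbs_le_zpow (μ : Measure F) [μ.IsAddHaarMeasure] (K : ℤ) :
    μ {b : F | normAbs F b ≤ ((residueFieldCard F : ℝ≥0)⁻¹) ^ (-K)} = (((residueFieldCard F : ℝ≥0) ^ K : ℝ≥0) : ℝ≥0∞) * μ {b : F | normAbs F b ≤ 1} := by
  obtain ⟨ϖ, hϖ0, hϖ⟩ := exists_normAbs_eq_inv (F := F)
  rw [setOf_normAbs_le_zpow_eq_smul hϖ hϖ0, addHaar_smul_set μ (zpow_ne_zero _ hϖ0), normAbs_zpow_of_normAbs_eq hϖ, inv_zpow', neg_neg]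

/-- **THE CORE COUNT, EVALUATED**: `∫⁻ b, μ'{a : (q⁻¹)^A ≤ |a| ∧ |a| Φ(b) ≤ (q⁻¹)^B} dμ ≤ n₊ · q^{⌊(n−1)/2⌋₊} · μ'(𝒪ˣ) · μ(𝒪)`, `n = A − B + l + 1`, for an additive HAAR measure `μ`.
At the consumer's values (`q^{-A} = |wN| q^{-m}`, `q^{-B} = q^m`, `q^{-l} = κ_E |w|`) this is `O_{E,m}(|w|⁻¹ log|w|⁻¹) = O(|D(γ₁)|^{-1/2} log)`: Theorem 14 for the elliptic torus of
`GL₂(F)`. [cite: HarishChandra1970, Part VII §1 Theorem 14 p. 60; §3 p. 72] [cite: Tate1950, §2.2 Lemma 2.2.5] -/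
theorem lintegral_measure_shellRange_le_zpow (μ' : Measure Fˣ) [μ'.IsMulLeftInvariant] (μ : Measure F) [μ.IsAddHaarMeasure] {Φ : F → ℝ≥0} {l : ℕ} {A B : ℤ}
    (hΦ : ∀ b, ((residueFieldCard F : ℝ≥0)⁻¹) ^ (l : ℤ) * max 1 (normAbs F b ^ 2) ≤ Φ b) :
    ∫⁻ b, μ' {a : Fˣ | ((residueFieldCard F : ℝ≥0)⁻¹) ^ A ≤ normAbs F (a : F) ∧ normAbs F (a : F) * Φ b ≤ ((residueFieldCard F : ℝ≥0)⁻¹) ^ B} ∂μ ≤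
      ((A - B + l + 1).toNat : ℝ≥0∞) * (((residueFieldCard F : ℝ≥0) ^ (((A - B + l + 1 - 1) / 2).toNat : ℤ) : ℝ≥0) : ℝ≥0∞) *
        μ' {x : Fˣ | valuation F (x : F) = 1} * μ {b : F | normAbs F b ≤ 1} := by
  refine (lintegral_measure_shellRange_le μ' μ hΦ).trans_eq ?_
  rw [measure_normAbs_le_zpow μ]
  ring

/-! ## §5 (ED. 2) The right-Haar (`k·n·a`) orientation

In the Iwasawa order `m = k · n_b · diag(a₁, a₂)` (★ `KNAQuotientIntegration`, no modulus factor) the Borel element is `a₂ · β` with `β = [[a, b], [0, 1]] = n_b · d_a`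
(`a = a₁/a₂`) and the induced measure on `β` is the RIGHT Haar measure `db dμ'(a) = |a| · dμ'(a) db'` in the coordinates `(a, b' = b/a)` of §3.  So the assembly in that
order needs the count with the weight `|a|` and the two integrations swapped; it is of the same size `q^{l−B} ≍ q^m |w|⁻¹`. -/

omit [MeasurableSpace F] [BorelSpace F] in
/-- For `|a| = (q⁻¹)^j` the `b`-section `{b : |a| Φ(b) ≤ (q⁻¹)^B}` is contained in the ball `{|b| ≤ (q⁻¹)^{-⌊t/2⌋}}`, `t = j + l − B`, and is EMPTY when `t < 0`.
[cite: HarishChandra1970, Part VII §3 p. 72] -/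
theorem setOf_mul_le_subset {Φ : F → ℝ≥0} {l : ℕ} {B : ℤ} (hΦ : ∀ b, ((residueFieldCard F : ℝ≥0)⁻¹) ^ (l : ℤ) * max 1 (normAbs F b ^ 2) ≤ Φ b)
    {a : Fˣ} {j : ℤ} (hj : normAbs F (a : F) = ((residueFieldCard F : ℝ≥0)⁻¹) ^ j) :
    {b : F | normAbs F (a : F) * Φ b ≤ ((residueFieldCard F : ℝ≥0)⁻¹) ^ B} ⊆
      {b : F | 0 ≤ j + l - B ∧ normAbs F b ≤ ((residueFieldCard F : ℝ≥0)⁻¹) ^ (-((j + l - B) / 2))} := by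
  intro b hb
  obtain ⟨k, hk, hbk⟩ := exists_max_one_sq_eq_zpow b
  have h1 : ((residueFieldCard F : ℝ≥0)⁻¹) ^ j * (((residueFieldCard F : ℝ≥0)⁻¹) ^ (l : ℤ) *
      ((residueFieldCard F : ℝ≥0)⁻¹) ^ (-(2 * (k : ℤ)))) ≤ ((residueFieldCard F : ℝ≥0)⁻¹) ^ B := by
    rw [← hk, ← hj]
    exact (mul_le_mul_of_nonneg_left (hΦ b) bot_le).trans hb
  rw [← zpow_add₀ inv_residueFieldCard_pos.ne', ← zpow_add₀ inv_residueFieldCard_pos.ne', inv_residueFieldCard_zpow_le_iff] at h1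
  refine ⟨by omega, hbk.trans (inv_residueFieldCard_zpow_le_iff.2 ?_)⟩
  omega

/-- **One `a`-shell, weighted**: for `|a| = (q⁻¹)^j`, `|a| · μ{b : |a| Φ(b) ≤ (q⁻¹)^B} ≤ (q⁻¹)^{B − l} · μ(𝒪)`, and `= 0` unless `B − l ≤ j`. [cite: HarishChandra1970, Part VII §3 p. 72]
[cite: Tate1950, §2.2 Lemma 2.2.5] -/
theorem normAbs_mul_measure_setOf_mul_le (μ : Measure F) [μ.IsAddHaarMeasure] {Φ : F → ℝ≥0} {l : ℕ} {B : ℤ}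
    (hΦ : ∀ b, ((residueFieldCard F : ℝ≥0)⁻¹) ^ (l : ℤ) * max 1 (normAbs F b ^ 2) ≤ Φ b) {a : Fˣ} {j : ℤ} (hj : normAbs F (a : F) = ((residueFieldCard F : ℝ≥0)⁻¹) ^ j) :
    (normAbs F (a : F) : ℝ≥0∞) * μ {b : F | normAbs F (a : F) * Φ b ≤ ((residueFieldCard F : ℝ≥0)⁻¹) ^ B} ≤
      (if j < B - l then 0 else ((((residueFieldCard F : ℝ≥0)⁻¹) ^ (B - l) : ℝ≥0) : ℝ≥0∞) * μ {b : F | normAbs F b ≤ 1}) := by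
  have hsub := setOf_mul_le_subset (B := B) hΦ hj
  split_ifs with hlt
  · -- empty section
    have h0 : {b : F | normAbs F (a : F) * Φ b ≤ ((residueFieldCard F : ℝ≥0)⁻¹) ^ B} = ∅ :=
      Set.eq_empty_of_subset_empty fun b hb => by have := (hsub hb).1; omega
    rw [h0, measure_empty, mul_zero]
  · push Not at hlt
    calc (normAbs F (a : F) : ℝ≥0∞) * μ {b : F | normAbs F (a : F) * Φ b ≤ ((residueFieldCard F : ℝ≥0)⁻¹) ^ B}
        ≤ (normAbs F (a : F) : ℝ≥0∞) * μ {b : F | normAbs F b ≤ ((residueFieldCard F : ℝ≥0)⁻¹) ^ (-((j + l - B) / 2))} :=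
          mul_le_mul_of_nonneg_left (measure_mono fun b hb => (hsub hb).2) bot_le
      _ = ((((residueFieldCard F : ℝ≥0)⁻¹) ^ j * (residueFieldCard F : ℝ≥0) ^ ((j + l - B) / 2) : ℝ≥0) : ℝ≥0∞) *
            μ {b : F | normAbs F b ≤ 1} := by
          rw [measure_normAbs_le_zpow μ, hj, ← mul_assoc, ← ENNReal.coe_mul]
      _ ≤ ((((residueFieldCard F : ℝ≥0)⁻¹) ^ (B - l) : ℝ≥0) : ℝ≥0∞) * μ {b : F | normAbs F b ≤ 1} := by
          gcongr
          have h2 : (residueFieldCard F : ℝ≥0) ^ ((j + l - B) / 2) = ((residueFieldCard F : ℝ≥0)⁻¹) ^ (-((j + l - B) / 2)) := by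
            rw [inv_zpow', neg_neg]
          rw [h2, ← zpow_add₀ inv_residueFieldCard_pos.ne', inv_residueFieldCard_zpow_le_iff]
          omega

/-- **THE CORE COUNT IN THE RIGHT-HAAR ORIENTATION**: `∫⁻_{a : (q⁻¹)^A ≤ |a|} |a| · μ{b : |a| Φ(b) ≤ (q⁻¹)^B} dμ'(a) ≤ n₊ · (q⁻¹)^{B−l} · μ'(𝒪ˣ) · μ(𝒪)`, `n = A − B + l + 1`:
the weighted `a`-shells `j ∈ [B − l, A]` each contribute at most `(q⁻¹)^{B−l} μ(𝒪) μ'(𝒪ˣ)`.  At the consumer's values (`(q⁻¹)^B = q^m`, `(q⁻¹)^l = κ_E|w|`) the bound is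
`n₊ · q^{m}(κ_E|w|)⁻¹ μ'(𝒪ˣ)μ(𝒪) = O_{E,m}(|D(γ₁)|^{-1/2} · log)` — Theorem 14 for the elliptic torus of `GL₂(F)` in the `k·n·a` orientation.
[cite: HarishChandra1970, Part VII §1 Theorem 14 p. 60; §3 p. 72] [cite: Tate1950, §2.5] -/
theorem setLIntegral_normAbs_mul_measure_le (μ' : Measure Fˣ) [μ'.IsMulLeftInvariant] (μ : Measure F) [μ.IsAddHaarMeasure] {Φ : F → ℝ≥0} {l : ℕ} {A B : ℤ}
    (hΦ : ∀ b, ((residueFieldCard F : ℝ≥0)⁻¹) ^ (l : ℤ) * max 1 (normAbs F b ^ 2) ≤ Φ b) :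
    ∫⁻ a in {a : Fˣ | ((residueFieldCard F : ℝ≥0)⁻¹) ^ A ≤ normAbs F (a : F)},
        (normAbs F (a : F) : ℝ≥0∞) * μ {b : F | normAbs F (a : F) * Φ b ≤ ((residueFieldCard F : ℝ≥0)⁻¹) ^ B} ∂μ' ≤
      ((A - B + l + 1).toNat : ℝ≥0∞) * ((((residueFieldCard F : ℝ≥0)⁻¹) ^ (B - l) : ℝ≥0) : ℝ≥0∞) *
        μ' {x : Fˣ | valuation F (x : F) = 1} * μ {b : F | normAbs F b ≤ 1} := by
  haveI : BorelSpace Fˣ := Units.borelSpace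
  set S : Set Fˣ := {a : Fˣ | ((residueFieldCard F : ℝ≥0)⁻¹) ^ A ≤ normAbs F (a : F)} with hS
  set U : Set Fˣ := ⋃ j ∈ Finset.Icc (B - l) A, {x : Fˣ | normAbs F (x : F) = ((residueFieldCard F : ℝ≥0)⁻¹) ^ j} with hU
  set c : ℝ≥0∞ := ((((residueFieldCard F : ℝ≥0)⁻¹) ^ (B - l) : ℝ≥0) : ℝ≥0∞) * μ {b : F | normAbs F b ≤ 1} with hc
  have hSm : MeasurableSet S :=
    measurableSet_le measurable_const (LocalFieldHaar.measurable_normAbs.comp Units.continuous_val.measurable)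
  have hUm : MeasurableSet U := Finset.measurableSet_biUnion _ fun j _ => measurableSet_normAbs_shell j
  -- pointwise on `S`: the weighted section is `≤ c · 1_U`
  have hpt : ∀ a ∈ S, (normAbs F (a : F) : ℝ≥0∞) * μ {b : F | normAbs F (a : F) * Φ b ≤ ((residueFieldCard F : ℝ≥0)⁻¹) ^ B} ≤
      U.indicator (fun _ => c) a := by
    intro a ha
    obtain ⟨j, hj⟩ := exists_normAbs_eq_inv_zpow a.ne_zero
    have ha' : ((residueFieldCard F : ℝ≥0)⁻¹) ^ A ≤ normAbs F (a : F) := ha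
    rw [hj] at ha'
    have hjA : j ≤ A := inv_residueFieldCard_zpow_le_iff.1 ha'
    refine (normAbs_mul_measure_setOf_mul_le μ hΦ hj (B := B)).trans ?_
    split_ifs with hlt
    · exact bot_le
    · have haU : a ∈ U := Set.mem_biUnion (Finset.mem_Icc.2 ⟨by omega, hjA⟩) hj
      rw [Set.indicator_of_mem haU]
  calc ∫⁻ a in S, (normAbs F (a : F) : ℝ≥0∞) * μ {b : F | normAbs F (a : F) * Φ b ≤ ((residueFieldCard F : ℝ≥0)⁻¹) ^ B} ∂μ'
      ≤ ∫⁻ a in S, U.indicator (fun _ => c) a ∂μ' := setLIntegral_mono' hSm hpt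
    _ = c * μ'.restrict S U := by rw [lintegral_indicator_const hUm]
    _ ≤ c * μ' U := mul_le_mul_of_nonneg_left (Measure.restrict_apply_le S U) bot_le
    _ ≤ c * (((A - B + l + 1).toNat : ℝ≥0∞) * μ' {x : Fˣ | valuation F (x : F) = 1}) := by
        gcongr
        refine (measure_biUnion_finset_le _ _).trans ?_
        simp only [measure_shell μ']
        rw [Finset.sum_const, nsmul_eq_mul, Int.card_Icc]
        gcongr
        norm_cast
        omega
    _ = _ := by rw [hc]; ring

/-! ## §6 (ED. 3) The anisotropy hypothesis for `Φ = |π(·)|`, `π = X² − TX + N₀` WITHOUT A ROOT IN `F`: `|disc π| · max(1,|x|²) ≤ C_π · |π(x)|`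

For the companion normal form `γ = leviBlock(C_π, c)` of a mixed regular element (`β C_π β⁻¹ = [[b/a, −a·π(b/a)], [1/a, T − b/a]]`) the count of §3∕§5 is fed with
`Φ(x) = |π(x)|`; the hypothesis `(q⁻¹)^l max(1,|x|²) ≤ Φ(x)` holds with `(q⁻¹)^l ≈ |disc π| / max(1, |T|², |N₀|)` — so `q^{⌊(n−1)/2⌋} ≍ q^m |disc π|^{-1/2} =
q^m |D_M(γ)|^{-1/2}` UNIFORMLY over all quadratic `π` (no classification of quadratic extensions).  The key inequality `|disc π| ≤ |π(x)|` is Hensel: if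
`|π(x)| < |π′(x)|²` then `h² + π′(x) h = −π(x)` is solvable (★ `K2E3LocalFieldSquaresHensel.exists_sq_add_mul_eq`) and `x + h` is a root; otherwise
`disc π = π′(x)² − 4π(x)` has `|disc π| ≤ |π(x)|`. -/

omit [MeasurableSpace F] [BorelSpace F] in
/-- `|n| ≤ 1` for a natural number `n` in a non-archimedean local field. [folklore] -/
theorem normAbs_natCast_le_one (n : ℕ) : normAbs F (n : F) ≤ 1 :=
  normAbs_le_one_iff.2 (natCast_mem 𝒪[F] n)

omit [MeasurableSpace F] [BorelSpace F] in
/-- **`|disc π| ≤ |π(x)|` for every `x ∈ F` when the monic quadratic `π = X² − TX + N₀` has NO root in `F`** (ultrametric Hensel).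
[cite: NeukirchANT1999, Ch. II §4 Lemma (4.6)] [cite: HarishChandra1970, Part VII §1 Theorem 14 p. 60] -/
theorem normAbs_discr_le_normAbs_eval {T N₀ : F} (hπ : ∀ x : F, x ^ 2 - T * x + N₀ ≠ 0) (x : F) :
    normAbs F (T ^ 2 - 4 * N₀) ≤ normAbs F (x ^ 2 - T * x + N₀) := by
  -- `disc = π'(x)² − 4 π(x)` with `π'(x) = 2x − T`
  have hdisc : T ^ 2 - 4 * N₀ = (2 * x - T) ^ 2 + (-4) * (x ^ 2 - T * x + N₀) := by ring
  by_cases hlt : normAbs F (x ^ 2 - T * x + N₀) < normAbs F (2 * x - T) ^ 2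
  · -- Hensel: a root `x + h` exists — contradiction
    exfalso
    have ha : 2 * x - T ≠ 0 := by
      intro h0
      rw [h0, map_zero, zero_pow two_ne_zero] at hlt
      exact not_lt_bot hlt
    have hy : normAbs F (-(x ^ 2 - T * x + N₀)) < normAbs F (2 * x - T) ^ 2 := by rwa [normAbs_neg]
    obtain ⟨h, hh, -⟩ := K2E3LocalFieldSquaresHensel.exists_sq_add_mul_eq ha hy
    refine hπ (x + h) ?_
    linear_combination hh
  · push Not at hlt
    rw [hdisc]
    refine (normAbs_add_le_max _ _).trans (max_le ?_ ?_)
    · rwa [map_pow]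
    · rw [map_mul, normAbs_neg]
      exact mul_le_of_le_one_left bot_le (normAbs_natCast_le_one (F := F) 4 |>.trans_eq' (by norm_cast))

omit [MeasurableSpace F] [BorelSpace F] in
/-- **`|π(x)| = |x|²` far out**: if `|T| < |x|` and `|N₀| < |x|²` then `|x² − Tx + N₀| = |x|²`. [folklore] -/
theorem normAbs_eval_eq_sq {T N₀ x : F} (hT : normAbs F T < normAbs F x) (hN : normAbs F N₀ < normAbs F x ^ 2) :
    normAbs F (x ^ 2 - T * x + N₀) = normAbs F x ^ 2 := by
  have hx0 : 0 < normAbs F x := lt_of_le_of_lt bot_le hT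
  have h1 : normAbs F (-(T * x)) < normAbs F (x ^ 2) := by
    rw [normAbs_neg, map_mul, map_pow, sq]
    exact mul_lt_mul_of_pos_right hT hx0
  have h2 : normAbs F (x ^ 2 + -(T * x)) = normAbs F x ^ 2 := by
    rw [LocalFieldHaar.normAbs_add_eq_of_lt h1, map_pow]
  have h3 : normAbs F N₀ < normAbs F (x ^ 2 + -(T * x)) := by rwa [h2]
  rw [show x ^ 2 - T * x + N₀ = (x ^ 2 + -(T * x)) + N₀ by ring, LocalFieldHaar.normAbs_add_eq_of_lt h3, h2]

omit [MeasurableSpace F] [BorelSpace F] in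
/-- **THE ANISOTROPY HYPOTHESIS OF THE CORE COUNT FOR `Φ = |π(·)|`**: if `π = X² − TX + N₀` has no root in `F` then for every `x ∈ F`
`|T² − 4N₀| · max(1, |x|²) ≤ max(1, |T|, |N₀|)² · |x² − Tx + N₀|` (small `x`: Hensel bound `|disc π| ≤ |π(x)|`; large `x`: `|π(x)| = |x|²` and `|disc π| ≤ max(1,|T|,|N₀|)²`).
So `hΦ` of ★ `lintegral_measure_shellRange_le` ∕ ★ `setLIntegral_normAbs_mul_measure_le` holds for `Φ = |π(·)|` with any `l` such that `(q⁻¹)^l ≤ |disc π| / max(1,|T|,|N₀|)²`,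
and the count is `≍ q^m |disc π|^{-1/2} = q^m |D_M(γ)|^{-1/2}` uniformly over all quadratic `π`.
[cite: HarishChandra1970, Part VII §1 Theorem 14 p. 60; §3 p. 72] [cite: NeukirchANT1999, Ch. II §4 Lemma (4.6)] -/
theorem normAbs_discr_mul_max_le {T N₀ : F} (hπ : ∀ x : F, x ^ 2 - T * x + N₀ ≠ 0) (x : F) :
    normAbs F (T ^ 2 - 4 * N₀) * max 1 (normAbs F x ^ 2) ≤ max 1 (max (normAbs F T) (normAbs F N₀)) ^ 2 * normAbs F (x ^ 2 - T * x + N₀) := by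
  set M : ℝ≥0 := max 1 (max (normAbs F T) (normAbs F N₀)) with hM
  have hM1 : 1 ≤ M := le_max_left _ _
  have hTM : normAbs F T ≤ M := (le_max_left _ _).trans (le_max_right _ _)
  have hNM : normAbs F N₀ ≤ M := (le_max_right _ _).trans (le_max_right _ _)
  -- `|disc π| ≤ M²`
  have hdM : normAbs F (T ^ 2 - 4 * N₀) ≤ M ^ 2 := by
    rw [sub_eq_add_neg]
    refine (normAbs_add_le_max _ _).trans (max_le ?_ ?_)
    · rw [map_pow]; gcongr
    · rw [normAbs_neg, map_mul, sq]
      exact mul_le_mul ((normAbs_natCast_le_one (F := F) 4 |>.trans_eq' (by norm_cast)).trans hM1) hNM bot_le bot_le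
  by_cases hx : normAbs F x ≤ M
  · -- small `x`: `max(1,|x|²) ≤ M²` and `|disc| ≤ |π(x)|`
    calc normAbs F (T ^ 2 - 4 * N₀) * max 1 (normAbs F x ^ 2)
        ≤ normAbs F (x ^ 2 - T * x + N₀) * M ^ 2 := by
          gcongr
          · exact normAbs_discr_le_normAbs_eval hπ x
          · exact max_le (one_le_pow₀ hM1) (by gcongr)
      _ = M ^ 2 * normAbs F (x ^ 2 - T * x + N₀) := mul_comm _ _
  · -- large `x`: `|π(x)| = |x|²`
    push Not at hx
    have hx1 : 1 ≤ normAbs F x := hM1.trans hx.le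
    have hπx : normAbs F (x ^ 2 - T * x + N₀) = normAbs F x ^ 2 :=
      normAbs_eval_eq_sq (hTM.trans_lt hx) (hNM.trans_lt (lt_of_lt_of_le hx (by nlinarith [hx1])))
    rw [hπx, max_eq_right (one_le_pow₀ hx1)]
    gcongr

end Summit.HodgeConjecture.HodgeConjecture.Cruxes.H413.K2E3GL2EllipticConjugacyCount

end
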